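import Mathlib

/-!
Venture QEDPrecision / cell `pub-qed`, unit `pub-qed-diag-1` (DIAG-1, gen 3). HONEST FRAMING: independent recomputation;
certified where stated, statistical where stated; no new-physics claim.  NEW WORK of the cell (a kernel-checked census), not a
published result; nothing here is cited as a fact anywhere.  The numbers certified are COUNTS in a finite combinatorial model,
stated below; they agree with the cell's two generators (HOME/data/diagrams/COUNTS.md and counts.json `by_n_loops`,
HOME/pub-qed-diag-2/COUNTS.md; HOME = run/shared/lean/pub/pub-qed/) and with the printed totals those were checked against
(AHKN, PRL 109, 111807 (2012), arXiv:1205.5368: 1, 7, 72, 891 vertex diagrams at orders e², e⁴, e⁶, e⁸, obtained by the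
Ward–Takahashi insertion from 1, 3, 18, 153 "self-energy-like" diagrams; Kinoshita–Nio, PRD 73, 013003 (2006): 518 of the 891
without lepton loops).  Staged copy: HOME/lean/diag1/SelfEnergyLikeGraphs.lean; Python mirror of every definition below:
HOME/code/diag1/lean_mirror/selfenergylike_model.py (its output = the rows certified here = the generators' tables).

# Kernel-checked census of QED self-energy-like graphs with lepton loops (orders e² … e¹⁰) and the Ward–Takahashi bookkeeping against the vertex graphs (orders e² … e⁸)

What this file adds to the directory.  `NoLoopVertexGraphs` (diag-2) certifies the loop-free vertex and self-energy rows
(orders 2–10) and `LeptonLoopGraphs*` (diag-2) the vertex graphs WITH lepton loops by loop structure (orders 2–10, orbit minima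
under the structure group, bridges decided by a loop-cluster criterion).  Here: (a) the SELF-ENERGY-LIKE graphs with lepton loops,
orders 2–10 — AHKN's 1, 3, 18, 153 and the cell's 1638 at order 10 — split by the number of lepton loops and weighted by their
Ward–Takahashi insertion places, which no other file of the directory treats; (b) the vertex rows 1, 7, 72, 891 split by the number
of loops and by "`X` on the open path / on a loop", re-derived by a DIFFERENT method from diag-2's (a canonical form by discovery
order, counted as fixed points rather than orbit minima, and a generic 2-edge-connectivity test by reachability after deleting
each line) — a second, independent kernel certificate of those numerals; (c) the WT identity on the numerals: vertex graphs with
`X` on the open path = insertion places of the self-energy-like graphs, 1 / 7 / 66 / 765.  The file imports Mathlib only.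

The combinatorial model (the one implemented, independently and differently, by the cell's two diagram generators
`code/diag1/qedgraphs.py` and `code/diag2/vgraphs.py`, and by diag-2's Lean files):

* a graph of order `2n` has `N` lepton-photon vertices, `N = 2n` (SELF-ENERGY-LIKE graph: `n` photons, all internal) or
  `N = 2n + 1` (VERTEX graph: `n` internal photons and the external-photon vertex `X`);
* the lepton lines form ONE open path with `m ≥ 1` vertices and any number of closed loops, each with an EVEN number `≥ 2` of
  vertices (odd loops vanish by Furry's theorem and are not counted, as in AHKN and Volkov); the internal photons are a perfect
  matching of the vertices other than `X`;
* the graph must be CONNECTED and ONE-PARTICLE IRREDUCIBLE: it stays connected after deleting any one internal line, lepton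
  or photon (this forbids self-energy parts on the external legs of a vertex graph and on the two external lepton legs of a
  self-energy-like graph; vacuum-polarisation insertions ARE 1PI and are counted, e.g. the order-e⁴ vertex graph with a lepton
  loop on the photon of the one-loop vertex, and the order-e⁴ self-energy with a loop on its photon);
* graphs are counted up to isomorphism of DIRECTED graphs (AHKN's convention: the open path and every loop carry an
  orientation; e.g. the light-by-light graphs with the two loop orientations are distinct — 6 graphs in Set IV(d) at order 8).

Isomorph rejection is done by CANONICAL LABELLING, certified here by brute force inside the kernel: a labelled configuration
is `(m, sizes, X, M)` — path vertices `0 … m-1` in path order, then the loops as consecutive blocks of sizes `sizes`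
(an ordered composition of `N - m` into even parts), each block `st … st+s-1` oriented `st → st+1 → … → st+s-1 → st`, the
position of `X`, and the matching `M`.  The DISCOVERY ORDER of a configuration lists the path first and then, scanning the
vertices already listed in order, appends the loop through the photon partner of the scanned vertex whenever that partner is
not yet listed, starting at the partner and following the loop's orientation.  The discovery order relabelled to `0 … N-1`
is a complete isomorphism invariant (it is intrinsic, and the configuration can be rebuilt from it), so every isomorphism
class of connected graphs contains EXACTLY ONE configuration whose discovery order is the identity; we count those
(`canonicalConnected`), among them the 2-edge-connected ones (`onePI`).  No deduplication table and no symmetry group is needed.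
The discovery-order canonical form is the one of diag-1's generator (`code/diag1/qedgraphs.py`, which applies it to all
configurations over non-increasing loop partitions and deduplicates the canonical forms in a hash set); diag-2 (`code/diag2/vgraphs.py`,
`LeptonLoopGraphs.lean`) instead minimises a key over the structure group; counting the fixed points of canonicalisation over
ordered compositions, as done here, is a third implementation.

Certified (kernel `decide`, no `native_decide`, no axioms beyond the standard ones), as rows
`[total, #graphs with 0, 1, 2, 3, 4 lepton loops, w]`:
* self-energy-like graphs, `w` = total number of open-path lepton lines `Σ (m - 1)` = number of Ward–Takahashi insertion places:
  order 2 `[1, 1,0,0,0,0, 1]` · order 4 `[3, 2,1,0,0,0, 7]` · order 6 `[18, 10,7,1,0,0, 66]` · order 8 `[153, 74,63,15,1,0, 765]` ·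
  order 10 `[1638, 706,689,216,26,1, 10374]`;
* vertex graphs, `w` = number of graphs with `X` on the open path:
  order 2 `[1, 1,0,0,0,0, 1]` · order 4 `[7, 6,1,0,0,0, 7]` · order 6 `[72, 50,21,1,0,0, 66]` · order 8 `[891, 518,327,45,1,0, 765]`
  (the order-10 vertex row, 12672 graphs over 332640 configurations, is diag-2's `LeptonLoopGraphsOrder10.order10_totals` and is
  not re-derived here; its split 10374 / 2298 by the position of `X` is the last entry of the order-10 self-energy row);
so that on the numerals: the no-loop columns reproduce `NoLoopVertexGraphs` (1/2/10/74/706 and 1/6/50/518); the loop columns of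
the vertex rows reproduce the structure tables of `LeptonLoopGraphs` (order 6: 21 = 12+9, 1 = 1; order 8: 327 = 150+102+75,
45 = 18+27, 1 = 1); the vertex graphs with `X` on the open path are exactly the WT insertions into the self-energy-like graphs
(1/7/66/765); and the remaining 0/0/6/126 vertex graphs have `X` on a lepton loop (light-by-light type; 6 = Set M6LL at order 6,
126 = 18+60+48 of Sets IV(a,b,c) at order 8 in the cell's tables).
-/

namespace Summit.Ventures.QEDPrecision.Diagrams.SelfEnergyLike

set_option Elab.async false

/-! ## matchings (as in `NoLoopVertexGraphs`, repeated inside this namespace so that the file depends on Mathlib only) -/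

/-- all perfect matchings of an increasing list of points, as lists of pairs `(a, b)`, `a` earlier than `b`;
first argument = fuel (number of pairs still to be formed). -/
def pm : ℕ → List ℕ → List (List (ℕ × ℕ))
  | 0, l => if l.isEmpty then [[]] else []
  | _ + 1, [] => []
  | k + 1, a :: rest =>
      rest.foldr (fun b acc => ((pm k (rest.erase b)).map (fun M => (a, b) :: M)) ++ acc) []

/-- photon partner of vertex `i` under the matching `M` (an unmatched vertex — the external vertex `X` — is its own partner). -/
def partner (M : List (ℕ × ℕ)) (i : ℕ) : ℕ :=
  match M.find? (fun e => Nat.beq e.1 i || Nat.beq e.2 i) with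
  | some e => bif Nat.beq e.1 i then e.2 else e.1
  | none => i

/-! Hot loops below are written over the kernel's GMP-accelerated primitives (`Nat.beq`, `Nat.ble`, `Nat.lor`, `Nat.xor`,
`Nat.shiftRight`, `Nat.pow`, …) and `bif`/`cond` directly, without type-class-mediated notation (`==`, `∈`, `if … then`),
which the kernel would otherwise unfold instance by instance at every comparison; visited sets and adjacency rows are
bitmasks (natural numbers). This only affects the cost of `decide +kernel`, not the meaning. -/

/-! ## skeleta: open path + even loops -/

/-- ordered compositions of `t` into even parts `≥ 2`; first argument is fuel (structural recursion). -/
def evenComps : ℕ → ℕ → List (List ℕ)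
  | _, 0 => [[]]
  | 0, _ + 1 => []
  | f + 1, t + 1 =>
      ((List.range ((t + 1) / 2)).map (fun j => 2 * (j + 1))).foldr
        (fun p acc => ((evenComps f (t + 1 - p)).map (fun c => p :: c)) ++ acc) []

/-- all skeleta on `N` vertices: `(m, sizes)`, open path with `m ≥ 1` vertices, loops of the listed even sizes. -/
def skeleta (N : ℕ) : List (ℕ × List ℕ) :=
  (List.range N).foldr (fun i acc => ((evenComps N (N - (i + 1))).map (fun c => (i + 1, c))) ++ acc) []

/-- loop blocks `(start, size)` of the skeleton `(m, sizes)`. -/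
def blocks : ℕ → List ℕ → List (ℕ × ℕ)
  | _, [] => []
  | st, s :: rest => (st, s) :: blocks (st + s) rest

/-- the block containing vertex `p`, if `p` is a loop vertex. -/
def blockOf (B : List (ℕ × ℕ)) (p : ℕ) : Option (ℕ × ℕ) :=
  B.find? (fun b => Nat.ble b.1 p && Nat.blt p (b.1 + b.2))

/-- lepton lines of the skeleton as ordered pairs `a → b`: open path `i → i+1` and the loop blocks. -/
def leptonEdges (m : ℕ) (B : List (ℕ × ℕ)) : List (ℕ × ℕ) :=
  ((List.range (m - 1)).map (fun i => (i, i + 1))) ++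
    B.foldr (fun b acc => ((List.range b.2).map (fun j => (b.1 + j, b.1 + (j + 1) % b.2))) ++ acc) []

/-! ## canonical labelling (discovery order = identity) and connectedness -/

/-- one step of the discovery scan at vertex `i`; state `some next` = vertices `0 … next-1` are listed so far,
`none` = the configuration is not canonical or not connected. -/
def scanStep (B : List (ℕ × ℕ)) (M : List (ℕ × ℕ)) (st : Option ℕ) (i : ℕ) : Option ℕ :=
  match st with
  | none => none
  | some next =>
      bif Nat.ble next i then none
      else
        let p := partner M i
        bif Nat.blt p next then some next
        else bif Nat.beq p next then
          match blockOf B p with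
          | some b => some (next + b.2)
          | none => none
        else none

/-- the configuration is connected AND is the canonical representative of its isomorphism class. -/
def canonicalConnected (N m : ℕ) (B : List (ℕ × ℕ)) (M : List (ℕ × ℕ)) : Bool :=
  match (List.range N).foldl (scanStep B M) (some m) with
  | some next => Nat.beq next N
  | none => false

/-! ## one-particle irreducibility (2-edge-connectivity) -/

/-- `2 ^ v`, the bitmask of vertex `v`. -/
def bit (v : ℕ) : ℕ := Nat.pow 2 v

/-- bit `v` of the mask `msk`. -/
def hasBit (msk v : ℕ) : Bool := Nat.beq (Nat.mod (Nat.shiftRight msk v) 2) 1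

/-- `i`-th entry of a list of masks (`0` beyond the end). -/
def nthD : List ℕ → ℕ → ℕ
  | [], _ => 0
  | a :: _, 0 => a
  | _ :: t, i + 1 => nthD t i

/-- OR the mask `w` into the `i`-th entry. -/
def upd : List ℕ → ℕ → ℕ → List ℕ
  | [], _, _ => []
  | a :: t, 0, w => Nat.lor a w :: t
  | a :: t, i + 1, w => a :: upd t i w

/-- adjacency rows (bitmasks) of the undirected multigraph with edge list `E` on `N` vertices (multiplicities are dropped; parallel
lines are handled by `mult` below). -/
def adjMasks (N : ℕ) (E : List (ℕ × ℕ)) : List ℕ :=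
  E.foldl (fun adj e => upd (upd adj e.1 (bit e.2)) e.2 (bit e.1)) (List.replicate N 0)

/-- one sweep of reachability growth: add the neighbours of every visited vertex, where vertex `a` uses the modified row `adjA`
(its row with the line under test deleted). -/
def grow (N a adjA : ℕ) (adj : List ℕ) (vis : ℕ) : ℕ :=
  (List.range N).foldl (fun acc v => bif hasBit vis v then Nat.lor acc (bif Nat.beq v a then adjA else nthD adj v) else acc) vis

/-- `t` is reached from the visited set within `k` more sweeps (first explicit argument after `adj` = fuel). -/
def reaches (N a adjA : ℕ) (adj : List ℕ) : ℕ → ℕ → ℕ → Bool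
  | 0, vis, t => hasBit vis t
  | k + 1, vis, t => hasBit vis t || reaches N a adjA adj k (grow N a adjA adj vis) t

/-- multiplicity of the unordered pair `{a, b}` in the edge list. -/
def mult (E : List (ℕ × ℕ)) (a b : ℕ) : ℕ :=
  (E.filter (fun e => (Nat.beq e.1 a && Nat.beq e.2 b) || (Nat.beq e.1 b && Nat.beq e.2 a))).length

/-- 1PI test for a CONNECTED configuration: after deleting any single internal line `e = {a, b}` the graph stays connected,
i.e. `b` is still reachable from `a` (for a connected graph the two are equivalent); a line with a parallel partner is never a
bridge.  Loop lepton lines lie on their loop and are never bridges, so only the `m - 1` open-path lepton lines and the photons are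
tested; deleting `e` only changes the adjacency row of `a` (the search starts at `a`, so `e` is never needed from `b`'s side);
`N - 1` sweeps suffice on `N` vertices. -/
def onePI (N m : ℕ) (LE : List (ℕ × ℕ)) (M : List (ℕ × ℕ)) : Bool :=
  let E := LE ++ M
  let adj := adjMasks N E
  (((List.range (m - 1)).map (fun i => (i, i + 1))) ++ M).all (fun e =>
    Nat.blt 1 (mult E e.1 e.2) || reaches N e.1 (Nat.xor (nthD adj e.1) (bit e.2)) adj (N - 1) (bit e.1) e.2)

/-! ## enumeration

The rows are accumulated PIECEWISE — vertex graphs by the position `x` of `X`, self-energy-like graphs by the photon partner `b`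
of vertex `0` (the first vertex of the open path) — and each heavy piece is certified as its own theorem: the kernel keeps every
intermediate term of ONE declaration alive, and a whole order-8 row in one declaration exceeds its memory bound, while the
pieces (≤ 1680 configurations each) do not.  `Elab.async false` keeps the pieces sequential, so that their memory does not add up. -/

/-- matchings of the points `pts` (increasing) in which the first point is paired with `b`. -/
def pmFirst : ℕ → List ℕ → ℕ → List (List (ℕ × ℕ))
  | k + 1, a :: rest, b => if rest.elem b then (pm k (rest.erase b)).map (fun M => (a, b) :: M) else []
  | _, _, _ => []

/-- the canonical connected 1PI configurations of ONE skeleton `sk = (m, sizes)` on `N` vertices over the matchings `Ms`,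
each recorded as `(number of lepton loops, w)`. -/
def graphsOf (N : ℕ) (sk : ℕ × List ℕ) (Ms : List (List (ℕ × ℕ))) (w : ℕ) : List (ℕ × ℕ) :=
  let B := blocks sk.1 sk.2
  let LE := leptonEdges sk.1 B
  (Ms.filter (fun M => canonicalConnected N sk.1 B M && onePI N sk.1 LE M)).map (fun _ => (sk.2.length, w))

/-- the row `[total, #graphs with 0, 1, 2, 3, 4 lepton loops, Σ w]` of a graph list. -/
def rowOf (L : List (ℕ × ℕ)) : List ℕ :=
  [L.length, (L.filter (fun g => Nat.beq g.1 0)).length, (L.filter (fun g => Nat.beq g.1 1)).length,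
    (L.filter (fun g => Nat.beq g.1 2)).length, (L.filter (fun g => Nat.beq g.1 3)).length, (L.filter (fun g => Nat.beq g.1 4)).length,
    (L.map (fun g => g.2)).sum]

/-- componentwise sum of rows. -/
def rowSum (rows : List (List ℕ)) : List ℕ :=
  rows.foldr (fun r acc => List.zipWith (fun u v => u + v) r acc) [0, 0, 0, 0, 0, 0, 0]

/-- vertex graphs of order `2n` (`N = 2n+1` vertices, `n` internal photons) with `X` at position `x`; weight `w = 1` if `X` lies on
the open path (`x < m`), else `0`. -/
def vertexGraphsAt (n x : ℕ) : List (ℕ × ℕ) :=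
  (skeleta (2 * n + 1)).foldr
    (fun sk acc => graphsOf (2 * n + 1) sk (pm n ((List.range (2 * n + 1)).erase x)) (bif Nat.blt x sk.1 then 1 else 0) ++ acc) []

/-- the row of the vertex graphs of order `2n` with `X` at position `x`. -/
def vertexRowAt (n x : ℕ) : List ℕ := rowOf (vertexGraphsAt n x)

/-- the row of ALL vertex graphs of order `2n`: `[total, #0, #1, #2, #3, #4 lepton loops, #(X on the open path)]`. -/
def vertexRow (n : ℕ) : List ℕ := rowSum ((List.range (2 * n + 1)).map (vertexRowAt n))

/-- self-energy-like graphs of order `2n` (`N = 2n` vertices, no `X`) in which vertex `0` has photon partner `b`; weight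
`w = m - 1` = the number of open-path lepton lines (Ward–Takahashi insertion places). -/
def selfEnergyGraphsAt (n b : ℕ) : List (ℕ × ℕ) :=
  (skeleta (2 * n)).foldr (fun sk acc => graphsOf (2 * n) sk (pmFirst n (List.range (2 * n)) b) (sk.1 - 1) ++ acc) []

/-- the row of the self-energy-like graphs of order `2n` in which vertex `0` has photon partner `b`. -/
def selfEnergyRowAt (n b : ℕ) : List ℕ := rowOf (selfEnergyGraphsAt n b)

/-- the row of ALL self-energy-like graphs of order `2n`: `[total, #0, #1, #2, #3, #4 lepton loops, Σ (m-1)]`. -/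
def selfEnergyRow (n : ℕ) : List ℕ := rowSum ((List.range (2 * n)).map (selfEnergyRowAt n))

/-! ## sanity of the enumerators -/

/-- `pm` enumerates `(2n-1)!!` matchings; even compositions of 6 are `[2,2,2],[2,4],[4,2],[6]`; the skeleta on 5 vertices;
hence the numbers of labelled configurations scanned: vertex graphs `Σ_skeleta N · (2n-1)!!` = 6, 60, 840, 15120 at orders 2–8,
self-energy-like graphs 1, 6, 60, 840, 15120 at orders 2–10. -/
theorem enumerators_explicit :
    ((pm 2 (List.range 4)).length = 3 ∧ (pm 3 (List.range 6)).length = 15 ∧ (pm 4 (List.range 8)).length = 105 ∧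
      (pm 5 (List.range 10)).length = 945) ∧
    evenComps 6 6 = [[2, 2, 2], [2, 4], [4, 2], [6]] ∧
    skeleta 5 = [(1, [2, 2]), (1, [4]), (3, [2]), (5, [])] ∧
    ((skeleta 7).length = 8 ∧ (skeleta 9).length = 16 ∧ (skeleta 10).length = 16) ∧
    pmFirst 2 (List.range 4) 2 = [[(0, 2), (1, 3)]] ∧ ((List.range 10).map (fun b => (pmFirst 5 (List.range 10) b).length)).sum = 945 := by
  decide +kernel

/-- order e²: the vertex graph `(m, sizes, X, M) = (3, [], 1, [(0,2)])` and the self-energy `(2, [], -, [(0,1)])` are the only ones;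
order e⁴ explicitly: the vacuum-polarisation insertion `(3,[2],1,[(0,3),(2,4)])` is canonical, connected and 1PI. -/
theorem order2_4_explicit :
    canonicalConnected 3 3 [] [(0, 2)] = true ∧
    canonicalConnected 5 3 (blocks 3 [2]) [(0, 3), (2, 4)] = true ∧
    onePI 5 3 (leptonEdges 3 (blocks 3 [2])) [(0, 3), (2, 4)] = true ∧
    -- the same graph with the loop labelled the other way round is not canonical:
    canonicalConnected 5 3 (blocks 3 [2]) [(0, 4), (2, 3)] = false ∧
    -- a self-energy part on an external leg is not 1PI:
    onePI 5 5 (leptonEdges 5 []) [(0, 1), (3, 4)] = false := by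
  decide +kernel

/-! ## the rows `[total, #0, #1, #2, #3, #4 lepton loops, w]` -/

/-- order e²: the one vertex graph (`X` on the path). -/
theorem vertexRow_order2 : vertexRow 1 = [1, 1, 0, 0, 0, 0, 1] := by decide +kernel
/-- order e²: the one self-energy graph, one insertion place. -/
theorem selfEnergyRow_order2 : selfEnergyRow 1 = [1, 1, 0, 0, 0, 0, 1] := by decide +kernel

/-- order e⁴: 7 vertex graphs, 6 loop-free and the vacuum-polarisation insertion; all with `X` on the path. -/
theorem vertexRow_order4 : vertexRow 2 = [7, 6, 1, 0, 0, 0, 7] := by decide +kernel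
/-- order e⁴: 3 self-energy-like graphs (AHKN), 2 loop-free, with 7 insertion places. -/
theorem selfEnergyRow_order4 : selfEnergyRow 2 = [3, 2, 1, 0, 0, 0, 7] := by decide +kernel

/-- order e⁶: 72 vertex graphs (AHKN), 50 loop-free, 21 / 1 with one / two loops, 66 with `X` on the path (6 light-by-light). -/
theorem vertexRow_order6 : vertexRow 3 = [72, 50, 21, 1, 0, 0, 66] := by decide +kernel
/-- order e⁶: 18 self-energy-like graphs (AHKN), 10 loop-free, with 66 insertion places. -/
theorem selfEnergyRow_order6 : selfEnergyRow 3 = [18, 10, 7, 1, 0, 0, 66] := by decide +kernel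

/-- order e⁸: 153 directed self-energy-like graphs (AHKN), 74 without loops, with 765 Ward–Takahashi insertion places
(840 configurations, one declaration). -/
theorem selfEnergyRow_order8 : selfEnergyRow 4 = [153, 74, 63, 15, 1, 0, 765] := by decide +kernel

/-! ### order e⁸ vertex graphs, by position `x = 0 … 8` of `X` (1680 configurations each)
`x = 0` is the incoming-leg vertex (a self-energy part on the leg: never 1PI); `x = 1` is the WT insertion into the first lepton line
of each of the 153 self-energy-like graphs; `x = 8` is the outgoing-leg vertex unless it lies on a lepton loop. -/

/-- order e⁸ vertex graphs, piece `x = 0`. -/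
theorem vertexRowAt_order8_x0 : vertexRowAt 4 0 = [0, 0, 0, 0, 0, 0, 0] := by decide +kernel
/-- order e⁸ vertex graphs, piece `x = 1`. -/
theorem vertexRowAt_order8_x1 : vertexRowAt 4 1 = [153, 74, 63, 15, 1, 0, 153] := by decide +kernel
/-- order e⁸ vertex graphs, piece `x = 2`. -/
theorem vertexRowAt_order8_x2 : vertexRowAt 4 2 = [128, 74, 48, 6, 0, 0, 128] := by decide +kernel
/-- order e⁸ vertex graphs, piece `x = 3`. -/
theorem vertexRowAt_order8_x3 : vertexRowAt 4 3 = [128, 74, 48, 6, 0, 0, 128] := by decide +kernel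
/-- order e⁸ vertex graphs, piece `x = 4`. -/
theorem vertexRowAt_order8_x4 : vertexRowAt 4 4 = [120, 74, 42, 4, 0, 0, 104] := by decide +kernel
/-- order e⁸ vertex graphs, piece `x = 5`. -/
theorem vertexRowAt_order8_x5 : vertexRowAt 4 5 = [120, 74, 42, 4, 0, 0, 104] := by decide +kernel
/-- order e⁸ vertex graphs, piece `x = 6`. -/
theorem vertexRowAt_order8_x6 : vertexRowAt 4 6 = [108, 74, 28, 6, 0, 0, 74] := by decide +kernel
/-- order e⁸ vertex graphs, piece `x = 7`. -/
theorem vertexRowAt_order8_x7 : vertexRowAt 4 7 = [104, 74, 28, 2, 0, 0, 74] := by decide +kernel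
/-- order e⁸ vertex graphs, piece `x = 8`. -/
theorem vertexRowAt_order8_x8 : vertexRowAt 4 8 = [30, 0, 28, 2, 0, 0, 0] := by decide +kernel

/-- order e⁸: 891 directed vertex graphs (AHKN), 518 without lepton loops (Kinoshita–Nio Group V), 327 / 45 / 1 with one / two /
three loops, 765 with `X` on the open path and 126 with `X` on a loop. -/
theorem vertexRow_order8 : vertexRow 4 = [891, 518, 327, 45, 1, 0, 765] := by
  rw [vertexRow, show List.range (2 * 4 + 1) = [0, 1, 2, 3, 4, 5, 6, 7, 8] from rfl]
  simp only [List.map, vertexRowAt_order8_x0, vertexRowAt_order8_x1, vertexRowAt_order8_x2, vertexRowAt_order8_x3,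
    vertexRowAt_order8_x4, vertexRowAt_order8_x5, vertexRowAt_order8_x6, vertexRowAt_order8_x7, vertexRowAt_order8_x8]
  rfl

/-! ### order e¹⁰ self-energy-like graphs, by photon partner `b = 0 … 9` of vertex `0` (1680 configurations each)
`b = 1` is a self-energy part on the first lepton line (never 1PI); `b = 9`, the photon spanning the whole path, forces no loops. -/

/-- order e¹⁰ self-energy-like graphs, piece `b = 0`. -/
theorem selfEnergyRowAt_order10_b0 : selfEnergyRowAt 5 0 = [0, 0, 0, 0, 0, 0, 0] := by decide +kernel
/-- order e¹⁰ self-energy-like graphs, piece `b = 1`. -/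
theorem selfEnergyRowAt_order10_b1 : selfEnergyRowAt 5 1 = [0, 0, 0, 0, 0, 0, 0] := by decide +kernel
/-- order e¹⁰ self-energy-like graphs, piece `b = 2`. -/
theorem selfEnergyRowAt_order10_b2 : selfEnergyRowAt 5 2 = [361, 74, 168, 99, 19, 1, 1279] := by decide +kernel
/-- order e¹⁰ self-energy-like graphs, piece `b = 3`. -/
theorem selfEnergyRowAt_order10_b3 : selfEnergyRowAt 5 3 = [153, 74, 63, 15, 1, 0, 1071] := by decide +kernel
/-- order e¹⁰ self-energy-like graphs, piece `b = 4`. -/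
theorem selfEnergyRowAt_order10_b4 : selfEnergyRowAt 5 4 = [303, 84, 150, 63, 6, 0, 1623] := by decide +kernel
/-- order e¹⁰ self-energy-like graphs, piece `b = 5`. -/
theorem selfEnergyRowAt_order10_b5 : selfEnergyRowAt 5 5 = [153, 84, 60, 9, 0, 0, 1173] := by decide +kernel
/-- order e¹⁰ self-energy-like graphs, piece `b = 6`. -/
theorem selfEnergyRowAt_order10_b6 : selfEnergyRowAt 5 6 = [249, 90, 129, 30, 0, 0, 1695] := by decide +kernel
/-- order e¹⁰ self-energy-like graphs, piece `b = 7`. -/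
theorem selfEnergyRowAt_order10_b7 : selfEnergyRowAt 5 7 = [135, 90, 45, 0, 0, 0, 1125] := by decide +kernel
/-- order e¹⁰ self-energy-like graphs, piece `b = 8`. -/
theorem selfEnergyRowAt_order10_b8 : selfEnergyRowAt 5 8 = [179, 105, 74, 0, 0, 0, 1463] := by decide +kernel
/-- order e¹⁰ self-energy-like graphs, piece `b = 9`. -/
theorem selfEnergyRowAt_order10_b9 : selfEnergyRowAt 5 9 = [105, 105, 0, 0, 0, 0, 945] := by decide +kernel

/-- order e¹⁰, self-energy-like graphs: 1638 directed graphs, 706 without loops (the parents of AHKN's Set V), 689 / 216 / 26 / 1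
with one … four loops, and 10374 WT insertion places (= the cell's count of order-10 vertex graphs with `X` on the open path; the
remaining 2298 of the 12672 have `X` on a loop). -/
theorem selfEnergyRow_order10 : selfEnergyRow 5 = [1638, 706, 689, 216, 26, 1, 10374] := by
  rw [selfEnergyRow, show List.range (2 * 5) = [0, 1, 2, 3, 4, 5, 6, 7, 8, 9] from rfl]
  simp only [List.map, selfEnergyRowAt_order10_b0, selfEnergyRowAt_order10_b1, selfEnergyRowAt_order10_b2,
    selfEnergyRowAt_order10_b3, selfEnergyRowAt_order10_b4, selfEnergyRowAt_order10_b5, selfEnergyRowAt_order10_b6,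
    selfEnergyRowAt_order10_b7, selfEnergyRowAt_order10_b8, selfEnergyRowAt_order10_b9]
  rfl

/-! ## consistency on the numerals -/

/-- Ward–Takahashi bookkeeping: vertex graphs with `X` on the open path = insertion places `Σ (m-1)` of the self-energy-like
graphs of the same order, orders 2–8 (1, 7, 66, 765), on the certified rows.  (The no-loop columns 1/6/50/518 and 1/2/10/74/706
are the directed counts certified, by a different enumeration, in `NoLoopVertexGraphs` of this directory.) -/
theorem wt_insertion_places :
    (vertexRow 1)[6]? = (selfEnergyRow 1)[6]? ∧ (vertexRow 2)[6]? = (selfEnergyRow 2)[6]? ∧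
      (vertexRow 3)[6]? = (selfEnergyRow 3)[6]? ∧ (vertexRow 4)[6]? = (selfEnergyRow 4)[6]? := by
  rw [vertexRow_order2, vertexRow_order4, vertexRow_order6, vertexRow_order8, selfEnergyRow_order2, selfEnergyRow_order4,
    selfEnergyRow_order6, selfEnergyRow_order8]
  decide

/-- the loop columns of the vertex rows against diag-2's structure tables (`LeptonLoopGraphs.order6_table`, `order8_table`;
not imported, compared on the numerals): one loop = (7,[2]) + (5,[4]) + (3,[6]), two loops = (5,[2,2]) + (3,[4,2]),
three loops = (3,[2,2,2]). -/
theorem loops_vs_structure_tables :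
    (vertexRow 3)[2]? = some (12 + 9) ∧ (vertexRow 3)[3]? = some 1 ∧
      (vertexRow 4)[2]? = some (150 + 102 + 75) ∧ (vertexRow 4)[3]? = some (18 + 27) ∧ (vertexRow 4)[4]? = some 1 := by
  rw [vertexRow_order6, vertexRow_order8]
  decide

end Summit.Ventures.QEDPrecision.Diagrams.SelfEnergyLike
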